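import Mathlib
import Summits.ValiantsHypothesis.ValiantsHypothesis.Theorems.ProofCarryingSymmetryRestorationQPACConverse

/-!
# Route ProofCarryingSymmetry — crux `RestorationQP`: an equivalent reformulation in the language of polynomial identities

The crux `RestorationQP` (every diagonally `S_n`-invariant VP family has `S_n`-symmetric Dawar–Wilsenach
circuits of quasi-polynomial total size) is EQUIVALENT to a statement about ordinary fan-in-two
straight-line circuits and Hrubeš–Tzameret's equational calculus:

  "AC-invariance at quasi-polynomial cost" — every diagonally `S_n`-invariant VP family `f` has, for some `c` and every
  `n`, a `PICircuit` `C` over `ℂ` with `Ĉ = f n`, `|C| ≤ 2^((log₂ n + c)^c)`, such that for every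
  `σ ∈ S_n` the unfoldings `(C ∘ σ)•` and `C•` are inter-derivable in `P_f(ℂ)` using only
  A1–A5 and the rules (no distributivity / unit / constant axioms) — i.e. are equal modulo
  associativity and commutativity.

`restorationQP_iff_acInvariantQP`: (⇒) is `acInvariantQP_of_restorationQP` (lay the symmetric circuit
out, B-core″); (⇐) is the landed stability rung S3″ `stub_stabilityAtACEquiv` (the AC-canonical circuit)
plus quasi-polynomial bookkeeping.  So the line's two open stubs T′ (qp `P_c` proofs of invariance)
and S2″ (proofs ⇒ AC-invariance of an equivalent circuit) are exactly a factorisation of this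
reformulation through PROOF LENGTH.  Registered helper: `restorationQP_iff_acInvariantQP` (the
right-hand side is written out; no new `Prop` is introduced).  Everything proved; no named facts.
-/

-- single-problem summit: `Summit.ValiantsHypothesis.ValiantsHypothesis.…` is the namespace by design (D-0017)
set_option linter.dupNamespace false

noncomputable section

namespace Summit.ValiantsHypothesis.ValiantsHypothesis.Theorems

open Literature.Computability.AlgebraicComplexity

/-- Quasi-polynomial bookkeeping: `(2^M + n + 2)^c₂ ≤ 2^((log₂ n + c)^c)` for `M = (log₂ n + c₁)^c₁`,
with `c = c₁ + c₂ + 3`. [folklore] -/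
theorem qp_pow_absorb (c₁ c₂ : ℕ) : ∃ c : ℕ, ∀ n : ℕ,
    (2 ^ ((Nat.log 2 n + c₁) ^ c₁) + n + 2) ^ c₂ ≤ 2 ^ ((Nat.log 2 n + c) ^ c) := by
  refine ⟨c₁ + c₂ + 3, fun n => ?_⟩
  have hn : n < 2 ^ (Nat.log 2 n + 1) := Nat.lt_pow_succ_log_self Nat.one_lt_two n
  generalize Nat.log 2 n = L at hn ⊢
  set M : ℕ := (L + c₁) ^ c₁ with hM
  set B : ℕ := L + (c₁ + c₂ + 3) with hB
  have h1 : 2 ^ M + n + 2 ≤ 2 ^ (M + L + 3) := by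
    have hA : 2 ^ M ≤ 2 ^ (M + L + 1) := Nat.pow_le_pow_right (by norm_num) (by omega)
    have hL1 : 2 ^ (L + 1) ≤ 2 ^ (M + L + 1) := Nat.pow_le_pow_right (by norm_num) (by omega)
    have h4 : 2 ^ (M + L + 3) = 2 ^ (M + L + 1) * 4 := by
      rw [show M + L + 3 = (M + L + 1) + 2 by omega, pow_add]; norm_num
    have hone : 1 ≤ 2 ^ (L + 1) := Nat.one_le_two_pow
    omega
  have h2 : (M + L + 3) * c₂ ≤ B ^ (c₁ + c₂ + 3) := by
    have hB1 : 1 ≤ B := by omega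
    have hB2 : 2 ≤ B := by omega
    have hMB : M ≤ B ^ (c₁ + c₂ + 1) :=
      calc M = (L + c₁) ^ c₁ := hM
        _ ≤ B ^ c₁ := Nat.pow_le_pow_left (by omega) _
        _ ≤ B ^ (c₁ + c₂ + 1) := Nat.pow_le_pow_right hB1 (by omega)
    have hLB : L + 3 ≤ B ^ (c₁ + c₂ + 1) :=
      calc L + 3 ≤ B := by omega
        _ = B ^ 1 := (pow_one B).symm
        _ ≤ B ^ (c₁ + c₂ + 1) := Nat.pow_le_pow_right hB1 (by omega)
    have hc₂B : c₂ ≤ B := by omega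
    calc (M + L + 3) * c₂ ≤ (2 * B ^ (c₁ + c₂ + 1)) * B := Nat.mul_le_mul (by omega) hc₂B
      _ ≤ (B * B ^ (c₁ + c₂ + 1)) * B := Nat.mul_le_mul_right _ (Nat.mul_le_mul_right _ hB2)
      _ = B ^ (c₁ + c₂ + 3) := by ring
  calc (2 ^ M + n + 2) ^ c₂ ≤ (2 ^ (M + L + 3)) ^ c₂ := Nat.pow_le_pow_left h1 _
    _ = 2 ^ ((M + L + 3) * c₂) := (pow_mul 2 _ _).symm
    _ ≤ 2 ^ (B ^ (c₁ + c₂ + 3)) := Nat.pow_le_pow_right (by norm_num) h2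

/-- **The crux in the language of polynomial identities** (registered helper of crux `RestorationQP`,
line `registered`): quasi-polynomial `S_n`-symmetric circuits exist for every diagonally invariant VP
family IF AND ONLY IF quasi-polynomial fan-in-two circuits that are symmetric up to associativity and
commutativity of their unfoldings do.  (⇒) lay the symmetric circuit out as a straight-line circuit
(`acInvariantQP_of_restorationQP`); (⇐) the AC-canonical circuit of such a circuit is symmetric, of
size `≤ (|C| + n + 2)^4` (`stub_stabilityAtACEquiv`). [folklore] -/
theorem restorationQP_iff_acInvariantQP : Summit.ValiantsHypothesis.ValiantsHypothesis.Theses.ProofCarryingSymmetry.RestorationQP ↔ ∀ f : (n : ℕ) → MvPolynomial (Fin n × Fin n) ℂ, (∀ (n : ℕ) (σ : Equiv.Perm (Fin n)), MvPolynomial.rename (fun x : Fin n × Fin n => σ • x) (f n) = f n) → IsVPFamily f → ∃ c : ℕ, ∀ n : ℕ, ∃ C : PICircuit ℂ (Fin n × Fin n), C.eval = f n ∧ C.size ≤ 2 ^ ((Nat.log 2 n + c) ^ c) ∧ ∀ σ : Equiv.Perm (Fin n), (pfSystem ℂ (Fin n × Fin n)).Provable (C.rename fun x : Fin n × Fin n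 => σ • x).unfold C.unfold ⊤ ACStability.acb := by
  constructor
  · exact acInvariantQP_of_restorationQP
  · intro h f hinv hVP
    obtain ⟨c₁, hc₁⟩ := h f hinv hVP
    obtain ⟨c₄, hc₄⟩ := stub_stabilityAtACEquiv
    obtain ⟨c, hc⟩ := qp_pow_absorb c₁ c₄
    refine ⟨c, fun n => ?_⟩
    obtain ⟨C, hCev, hCsize, hCac⟩ := hc₁ n
    obtain ⟨G, hG, D, hsym, hDev, hcard⟩ := hc₄ n C (fun σ => by
      have := hCac σ
      unfold ACStability.acb at this
      exact this)
    refine ⟨G, hG, D, hsym, hDev.trans hCev, hcard.trans ?_⟩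
    exact (Nat.pow_le_pow_left (by omega) _).trans (hc n)

end Summit.ValiantsHypothesis.ValiantsHypothesis.Theorems

end
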